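/-
Origin: expansion seat `planner-pub-hodgecm-prl1-g2-0`, handover #2 v2 2026-08-18 (`HOME/pub-hodgecm-prl1-g2/lean/Prl1g2/CorCMPrintLeaves.lean`, md5 8e428122, 181 lines);
landed by the gen-6 packager in gate run 22 as `HodgeCM/Assembly/CorCMPrintLeaves.lean` (import ^import CarverG2\.PerL34\.→import HodgeCM.PerL34. ×1).
-/
/-
Origin: HOME/pub-hodgecm-prl1-g2/lean/Prl1g2/CorCMPrintLeaves.lean — session planner-pub-hodgecm-prl1-g2-0
(unit pub-hodgecm-prl1-g2, EXPANSION PROVER a-1 gen 2 on `RealisationExistsPerL` / `RealisationExistsFace`).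
Intended final place (packager's call): `HodgeCM/Assembly/CorCMPrintLeaves.lean`; module rename `Prl1g2.` ↦ `HodgeCM.Assembly.`.
WIP imports (PACKAGER: rewrite `CarverG2.PerL34.AssemblyPrint` → `HodgeCM.PerL34.AssemblyPrint` (carver-g2 v3 11edfc4a (v2 ebe46ef9 = same statements), run-22
queue); lands AFTER it, i.e. after carver-g2 `AssemblyDict` v2 03977e9e, pv02-g2 `CharSpans` 9c9ff4da / `QautDictionary` 2558dd61,
pv11 `SeesawDictionary` f942ea4b, pv04-g2 `ThetaSubOfLiu`).  `HodgeCM.Assembly.CorCMEndState` is LANDED (run 19).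
NEW, ADDITIVE; touches no existing file; independent of my `CorCMLeaves.lean` (either may land first).

KIND: KERNEL glue (L5 assembly).  NOTHING is cited or posited here: every declaration is a one-line composition of
audited / handed-over theorems.

# `T.Inputs`, both realisation inputs, `U.OpenInputs` and the COR-CM END STATE from the PRINT leaves and the
# DICTIONARY records (LEMMAS.md v6 §9, seams S1–S6 fed BY NAME) — the `A : T.Inputs` binder eliminated one level further
# down than in `CorCMLeaves.lean`

The carver's `HodgeCM.PerL34.perL_of_dictLeaves` / `perL_of_printDictLeaves` (`AssemblyDict.lean` / `AssemblyPrint.lean`)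
conclude `U.PerL`.  This file factors the same wiring through the ten-field record `T.Inputs`, so that the cell's HEADLINE
`U.HC_CM` and the two prl1 OPEN INPUTS `U.RealisationExistsPerL` / `U.RealisationExistsFace` get the same binder census:

* `inputs_of_dictLeaves` : binders of `perL_of_dictLeaves` minus `M`/`h07` ⟹ `T.Inputs`
  (`axioms_of_nodes` with h19w := `N19w_wedgeMem_of_bridges` (S5 (12)-half, pv11 `SeesawBridge`), h19g :=
  `N19g_genInWedgeSpan_of_core`, h29 := `N29_occ_of_archC` (S4), h31 := `N31_chars_of_cluster` (S3), h33 :=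
  `N33_wedge_of_charSpans` (S1+S2, pv02-g2 `CharSpanStepsInput`));
* `inputs_of_printDictLeaves` : binders of `perL_of_printDictLeaves` minus `h07` ⟹ `T.Inputs`
  (additionally h12a := `N12a_thetaSub_of_split M T hM38 hAlb` (S6, pv04-g2: `U.Fact_cmInflation` = model fact M38 (proposed), PRINT Shimura 1998
  §6.2 Thm 3; `T.Fact_thetaAlbanese` = PRINT-INTERFACE [Liu21] arXiv:2102.11518 Prop 4.13 + Thm 4.18) and hcore := pv02-g2's KERNEL
  `QautDictionary.N19g_core_of_bridge` over `hQ` (S5 (34)-half));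
* `realisationExists_of_printDictLeaves` : `U.RealisationExistsPerL ∧ U.RealisationExistsFace`;
* `openInputs_of_printDictLeaves` : the record `U.OpenInputs` (+ `(hP : U.PohlmannSpan) (hQw : U.Qw8Sufficiency)`);
* `COR_CM_of_printDictLeaves` : `U.HC_CM` via `Assembly.COR_CM_theta''`;
* `COR_CM_endState_of_printDictLeaves` : `Assembly.COR_CM_endState` with `A : T.Inputs` REPLACED — binder census:
  `M : U.ModelAxioms`, M29/M30 (`h29 h30`), the three [QW8]-side inputs (`hE hD hMi`), PRINT leaves `h07 h09a h09b hM38 hAlb`,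
  DESIGN `h12b`, seam S5 `hbr` ((12)-half: pv11 `SeesawBridge`, dictionary fields `Λ_wedge`/`ϑ_period`) and `hQ` ((34)-half:
  pv02-g2 `QautBridge`), seam S4 `Pc A12 A34` (`ArchCDatum`), seam S3 `h31 : ClusterOutputs T`, seams S1+S2
  `h33 : CharSpans.CharSpanStepsInput T`.
PROVED; closure = the standard trio.
-/
import Summits.HodgeConjecture.HodgeCM.PerL34.AssemblyPrint
import Summits.HodgeConjecture.HodgeCM.Assembly.CorCMEndState

/-! PORT of `HodgeCM/Assembly/CorCMPrintLeaves.lean` (HodgeCMPerL run 82) — verbatim mechanical port; provenance in the PORT header line. -/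

set_option autoImplicit false

noncomputable section

namespace HodgeCM
namespace PerL34

open HodgeCM.Prior.Perl34File HodgeCM.Prior.Perl34File.Perl34 HodgeCM.PerL34.ArchC

variable {U : Universe}

/-- **`T.Inputs` from the dictionary-level leaves** (cf. `perL_of_dictLeaves`): `axioms_of_nodes` with N19w, N19g, N29,
N31, N33 fed BY NAME. -/
theorem inputs_of_dictLeaves (T : U.ThetaModel) (h09a : N09a_embCover T) (h09b : N09b_innerEmb T)
    (h12a : N12a_thetaSub T) (h12b : N12b_signRecipe T)
    (hbr : ∀ {L : CMField} {ι₁ : L →+* ℂ} (V : HermSpace3 L ι₁) (c : SeesawCtx L), T.GoodCtx ι₁ c →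
      Nonempty (SeesawDictionary.SeesawBridge T V c (T.t12 V c) 0 1))
    (hcore : ∀ {L : CMField} {ι₁ : L →+* ℂ} (V : HermSpace3 L ι₁) (c : SeesawCtx L), T.GoodCtx ι₁ c →
      N19g_core T V c (T.t34 V c) 2 3)
    (Pc : ∀ {L : CMField} {ι₁ : L →+* ℂ} (V : HermSpace3 L ι₁) (c : SeesawCtx L),
      C4a.PointedCore (T.core V c))
    (A12 : ∀ {L : CMField} {ι₁ : L →+* ℂ} (V : HermSpace3 L ι₁) (c : SeesawCtx L),
      T.GoodCtx ι₁ c → Nonempty (ArchCDatum (T.core V c) (T.t12 V c) (Pc V c)))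
    (A34 : ∀ {L : CMField} {ι₁ : L →+* ℂ} (V : HermSpace3 L ι₁) (c : SeesawCtx L),
      T.GoodCtx ι₁ c → Nonempty (ArchCDatum (T.core V c) (T.t34 V c) (Pc V c)))
    (h31 : ClusterOutputs T) (h33 : CharSpans.CharSpanStepsInput T) : T.Inputs :=
  axioms_of_nodes T h09a h09b h12a h12b (N19w_wedgeMem_of_bridges T hbr h31) (N19g_genInWedgeSpan_of_core T hcore)
    (N29_occ_of_archC T Pc A12 A34) (N31_chars_of_cluster T h31) (N33_wedge_of_charSpans T h31 h33)

/-- **`T.Inputs` from the PRINT leaves and DICTIONARY records** (cf. `perL_of_printDictLeaves`): additionally N12a fed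
BY NAME through pv04-g2's split (`N12a_thetaSub_of_split`) and the (34)-core through pv02-g2's `QautBridge`
(`QautDictionary.N19g_core_of_bridge`).  Needs `M` (for `Fact_pull_comp` / `Fact_alphaLine` inside the split). -/
theorem inputs_of_printDictLeaves (M : U.ModelAxioms) (T : U.ThetaModel)
    (h09a : N09a_embCover T) (h09b : N09b_innerEmb T)
    (hM38 : U.Fact_cmInflation) (hAlb : T.Fact_thetaAlbanese) (h12b : N12b_signRecipe T)
    (hbr : ∀ {L : CMField} {ι₁ : L →+* ℂ} (V : HermSpace3 L ι₁) (c : SeesawCtx L), T.GoodCtx ι₁ c →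
      Nonempty (SeesawDictionary.SeesawBridge T V c (T.t12 V c) 0 1))
    (hQ : ∀ {L : CMField} {ι₁ : L →+* ℂ} (V : HermSpace3 L ι₁) (c : SeesawCtx L), T.GoodCtx ι₁ c →
      Nonempty (QautDictionary.QautBridge T V c (T.t34 V c) 2 3))
    (Pc : ∀ {L : CMField} {ι₁ : L →+* ℂ} (V : HermSpace3 L ι₁) (c : SeesawCtx L),
      C4a.PointedCore (T.core V c))
    (A12 : ∀ {L : CMField} {ι₁ : L →+* ℂ} (V : HermSpace3 L ι₁) (c : SeesawCtx L),
      T.GoodCtx ι₁ c → Nonempty (ArchCDatum (T.core V c) (T.t12 V c) (Pc V c)))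
    (A34 : ∀ {L : CMField} {ι₁ : L →+* ℂ} (V : HermSpace3 L ι₁) (c : SeesawCtx L),
      T.GoodCtx ι₁ c → Nonempty (ArchCDatum (T.core V c) (T.t34 V c) (Pc V c)))
    (h31 : ClusterOutputs T) (h33 : CharSpans.CharSpanStepsInput T) : T.Inputs :=
  inputs_of_dictLeaves T h09a h09b (N12a_thetaSub_of_split M T hM38 hAlb) h12b hbr
    (fun V c hc => (hQ V c hc).elim fun B => QautDictionary.N19g_core_of_bridge B) Pc A12 A34 h31 h33

/-- **Both realisation inputs of `U.OpenInputs` from the print leaves and dictionary records**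
(`ThetaModel.realisationExists_of''` over `inputs_of_printDictLeaves`) — the prl1 target pair with no `A : T.Inputs`
binder and every PerL v5 §§3–4 node fed BY NAME. -/
theorem realisationExists_of_printDictLeaves (M : U.ModelAxioms) (T : U.ThetaModel)
    (h07 : N07_hodgeRiemann20 U) (h09a : N09a_embCover T) (h09b : N09b_innerEmb T)
    (hM38 : U.Fact_cmInflation) (hAlb : T.Fact_thetaAlbanese) (h12b : N12b_signRecipe T)
    (hbr : ∀ {L : CMField} {ι₁ : L →+* ℂ} (V : HermSpace3 L ι₁) (c : SeesawCtx L), T.GoodCtx ι₁ c →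
      Nonempty (SeesawDictionary.SeesawBridge T V c (T.t12 V c) 0 1))
    (hQ : ∀ {L : CMField} {ι₁ : L →+* ℂ} (V : HermSpace3 L ι₁) (c : SeesawCtx L), T.GoodCtx ι₁ c →
      Nonempty (QautDictionary.QautBridge T V c (T.t34 V c) 2 3))
    (Pc : ∀ {L : CMField} {ι₁ : L →+* ℂ} (V : HermSpace3 L ι₁) (c : SeesawCtx L),
      C4a.PointedCore (T.core V c))
    (A12 : ∀ {L : CMField} {ι₁ : L →+* ℂ} (V : HermSpace3 L ι₁) (c : SeesawCtx L),
      T.GoodCtx ι₁ c → Nonempty (ArchCDatum (T.core V c) (T.t12 V c) (Pc V c)))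
    (A34 : ∀ {L : CMField} {ι₁ : L →+* ℂ} (V : HermSpace3 L ι₁) (c : SeesawCtx L),
      T.GoodCtx ι₁ c → Nonempty (ArchCDatum (T.core V c) (T.t34 V c) (Pc V c)))
    (h31 : ClusterOutputs T) (h33 : CharSpans.CharSpanStepsInput T) :
    U.RealisationExistsPerL ∧ U.RealisationExistsFace :=
  T.realisationExists_of'' M (inputs_of_printDictLeaves M T h09a h09b hM38 hAlb h12b hbr hQ Pc A12 A34 h31 h33) h07

/-- **The record `U.OpenInputs` from the print leaves and dictionary records** plus `PohlmannSpan` / `Qw8Sufficiency`. -/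
theorem openInputs_of_printDictLeaves (M : U.ModelAxioms) (T : U.ThetaModel)
    (h07 : N07_hodgeRiemann20 U) (h09a : N09a_embCover T) (h09b : N09b_innerEmb T)
    (hM38 : U.Fact_cmInflation) (hAlb : T.Fact_thetaAlbanese) (h12b : N12b_signRecipe T)
    (hbr : ∀ {L : CMField} {ι₁ : L →+* ℂ} (V : HermSpace3 L ι₁) (c : SeesawCtx L), T.GoodCtx ι₁ c →
      Nonempty (SeesawDictionary.SeesawBridge T V c (T.t12 V c) 0 1))
    (hQ : ∀ {L : CMField} {ι₁ : L →+* ℂ} (V : HermSpace3 L ι₁) (c : SeesawCtx L), T.GoodCtx ι₁ c →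
      Nonempty (QautDictionary.QautBridge T V c (T.t34 V c) 2 3))
    (Pc : ∀ {L : CMField} {ι₁ : L →+* ℂ} (V : HermSpace3 L ι₁) (c : SeesawCtx L),
      C4a.PointedCore (T.core V c))
    (A12 : ∀ {L : CMField} {ι₁ : L →+* ℂ} (V : HermSpace3 L ι₁) (c : SeesawCtx L),
      T.GoodCtx ι₁ c → Nonempty (ArchCDatum (T.core V c) (T.t12 V c) (Pc V c)))
    (A34 : ∀ {L : CMField} {ι₁ : L →+* ℂ} (V : HermSpace3 L ι₁) (c : SeesawCtx L),
      T.GoodCtx ι₁ c → Nonempty (ArchCDatum (T.core V c) (T.t34 V c) (Pc V c)))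
    (h31 : ClusterOutputs T) (h33 : CharSpans.CharSpanStepsInput T)
    (hP : U.PohlmannSpan) (hQw : U.Qw8Sufficiency) : U.OpenInputs :=
  let hR := realisationExists_of_printDictLeaves M T h07 h09a h09b hM38 hAlb h12b hbr hQ Pc A12 A34 h31 h33
  { realisation_perL := hR.1, realisation_face := hR.2, pohlmann_span := hP, qw8_sufficiency := hQw }

end PerL34

namespace Assembly

open HodgeCM.Prior.Perl34File HodgeCM.Prior.Perl34File.Perl34 HodgeCM.PerL34 HodgeCM.PerL34.ArchC

variable (U : Universe)

/-- **COR-CM from the print leaves and dictionary records**: `COR_CM_theta''` with `A : T.Inputs` replaced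
(`inputs_of_printDictLeaves`). -/
theorem COR_CM_of_printDictLeaves (M : U.ModelAxioms) (T : U.ThetaModel)
    (h07 : N07_hodgeRiemann20 U) (h09a : N09a_embCover T) (h09b : N09b_innerEmb T)
    (hM38 : U.Fact_cmInflation) (hAlb : T.Fact_thetaAlbanese) (h12b : N12b_signRecipe T)
    (hbr : ∀ {L : CMField} {ι₁ : L →+* ℂ} (V : HermSpace3 L ι₁) (c : SeesawCtx L), T.GoodCtx ι₁ c →
      Nonempty (SeesawDictionary.SeesawBridge T V c (T.t12 V c) 0 1))
    (hQ : ∀ {L : CMField} {ι₁ : L →+* ℂ} (V : HermSpace3 L ι₁) (c : SeesawCtx L), T.GoodCtx ι₁ c →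
      Nonempty (QautDictionary.QautBridge T V c (T.t34 V c) 2 3))
    (Pc : ∀ {L : CMField} {ι₁ : L →+* ℂ} (V : HermSpace3 L ι₁) (c : SeesawCtx L),
      C4a.PointedCore (T.core V c))
    (A12 : ∀ {L : CMField} {ι₁ : L →+* ℂ} (V : HermSpace3 L ι₁) (c : SeesawCtx L),
      T.GoodCtx ι₁ c → Nonempty (ArchCDatum (T.core V c) (T.t12 V c) (Pc V c)))
    (A34 : ∀ {L : CMField} {ι₁ : L →+* ℂ} (V : HermSpace3 L ι₁) (c : SeesawCtx L),
      T.GoodCtx ι₁ c → Nonempty (ArchCDatum (T.core V c) (T.t34 V c) (Pc V c)))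
    (h31 : ClusterOutputs T) (h33 : CharSpans.CharSpanStepsInput T)
    (hP : U.PohlmannSpan) (hQw : U.Qw8Sufficiency) : U.HC_CM :=
  COR_CM_theta'' U M T (inputs_of_printDictLeaves M T h09a h09b hM38 hAlb h12b hbr hQ Pc A12 A34 h31 h33) h07 hP hQw

/-- **COR-CM, END STATE from the print leaves and dictionary records**: `COR_CM_endState` with its binder
`A : T.Inputs` replaced.  Remaining hypotheses: `M`, M29/M30, the three [QW8]-side inputs, PRINT `h07 h09a h09b hM38 hAlb`,
DESIGN `h12b`, S5 `hbr`/`hQ`, S4 `Pc A12 A34`, S3 `h31`, S1+S2 `h33`. -/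
theorem COR_CM_endState_of_printDictLeaves (M : U.ModelAxioms) (h29 : U.Fact_weightSpan) (h30 : U.Fact_weightHodge)
    (hE : U.Qw8ExtProd) (hD : U.Qw8DualPushPull) (hMi : U.Qw8Milne) (T : U.ThetaModel)
    (h07 : N07_hodgeRiemann20 U) (h09a : N09a_embCover T) (h09b : N09b_innerEmb T)
    (hM38 : U.Fact_cmInflation) (hAlb : T.Fact_thetaAlbanese) (h12b : N12b_signRecipe T)
    (hbr : ∀ {L : CMField} {ι₁ : L →+* ℂ} (V : HermSpace3 L ι₁) (c : SeesawCtx L), T.GoodCtx ι₁ c →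
      Nonempty (SeesawDictionary.SeesawBridge T V c (T.t12 V c) 0 1))
    (hQ : ∀ {L : CMField} {ι₁ : L →+* ℂ} (V : HermSpace3 L ι₁) (c : SeesawCtx L), T.GoodCtx ι₁ c →
      Nonempty (QautDictionary.QautBridge T V c (T.t34 V c) 2 3))
    (Pc : ∀ {L : CMField} {ι₁ : L →+* ℂ} (V : HermSpace3 L ι₁) (c : SeesawCtx L),
      C4a.PointedCore (T.core V c))
    (A12 : ∀ {L : CMField} {ι₁ : L →+* ℂ} (V : HermSpace3 L ι₁) (c : SeesawCtx L),
      T.GoodCtx ι₁ c → Nonempty (ArchCDatum (T.core V c) (T.t12 V c) (Pc V c)))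
    (A34 : ∀ {L : CMField} {ι₁ : L →+* ℂ} (V : HermSpace3 L ι₁) (c : SeesawCtx L),
      T.GoodCtx ι₁ c → Nonempty (ArchCDatum (T.core V c) (T.t34 V c) (Pc V c)))
    (h31 : ClusterOutputs T) (h33 : CharSpans.CharSpanStepsInput T) : U.HC_CM :=
  COR_CM_endState U M h29 h30 hE hD hMi T
    (inputs_of_printDictLeaves M T h09a h09b hM38 hAlb h12b hbr hQ Pc A12 A34 h31 h33) h07

end Assembly
end HodgeCM

end
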